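import Summits.HodgeConjecture.HodgeConjecture.Theorems.F0P2oHeisenbergYCoinvariantsSchur   -- ★ p831043: descent to `S_Y` (`exists_descent_of_implements`), ★ p830834 §3 equivariance
import Literature.RepresentationTheory.HeisenbergGroup.SchrodingerCommutantPi                 -- ★ `commutant_schrodingerSB_pi`
import HarnessLib

/-!
# Crux `H413`, programme P2, N3 road (a)-block (E2) — DESCENT OF A `Y`-STABLE IMPLEMENTER TO THE FIBRE `S_Y` IS AN IMPLEMENTER OF THE INDUCED
# SYMPLECTIC MAP ON `𝕎₁ = Y^⊥ ∕ Y`, HENCE UNIQUE UP TO A SCALAR («the dictionary up to a character», model level)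

Cell hodgecm-mathlib (D-0151), FLOOR 0, crux item H413 = stmt-HodgeConjecture-24833, programme P2; N3 road (`F0/P2/B-p18/g28/N3-ROAD.v2.B-p18g28.md`),
(a)-block, row (S5) «THE DICTIONARY» (lead B-p18 (g28) 20:49:54Z, desk F0P2-plan (g8) 20:50:18Z), seat F0P2-p01 (g8), brick (E2) over (E1)
`F0P2oYCoinvariantsChart` (the chart export).  THEOREMS ONLY (no `def`, no instance, no notation, no named fact, no `sorry`); never imports a `Cruxes/…/Lines`
module; kernel lane `--supports stmt-HodgeConjecture-24833 --as helper`.  HC_CM is proved only modulo the printed citations until rung 0 closes; nothing printed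
is asserted here.

THE MATHEMATICS (the `Y`-adapted dot model of ★ p830834: `𝕎 = F^{ι₁ ⊔ ι₀} × F^{ι₁ ⊔ ι₀}`, `Y = 0 × (F^{ι₁} × 0)`, `Y^⊥ = {w : w.1|ι₁ = 0}`, `𝕎₁ = Y^⊥ ∕ Y` read on
the `ι₀`-coordinates, `S_Y = 𝒮(F^{ι₀})` through the fibre-over-`0` map `φ₀`).  Let `(g, M) ∈ S̃p_ψ(𝕎)` (★ `MpPsi`) with `g Y ⊆ Y` (`hY`), `g Y^⊥ ⊆ Y^⊥` and
`g` inducing the symplectic map `g₀` of `𝕎₁` (`hYp`).  Then: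
* §1 Weil's quadratic correction of `g` on `Y^⊥` IS that of `g₀` on `𝕎₁` (`ofSymplectic_f_eq_of_induced`), so Weil's section commutes with passing to `Y^⊥ ∕ Y`
  (`act_ofSymplectic_inr_eq_of_induced`). [Weil1964, n° 5]
* §2 **`exists_descent_implements`**: `M` DESCENDS to a linear operator `D` of `S_Y` (`D ∘ φ₀ = φ₀ ∘ M`, ★ p831043 `exists_descent_of_implements`) and the
  descended operator IMPLEMENTS `ofSymplectic g₀` in the Schrödinger model `ρ₀` of `H(𝕎₁)`: `D (ρ₀(h₀) u) = ρ₀(g₀ · h₀) (D u)` (★ p830834 §3 equivariance of `φ₀`).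
  [MoeglinVignerasWaldspurger1987, Chap. 3 §IV.2; Kudla1986, proof of Thm. 2.8]
* §3 **`exists_eq_smul_toRep_of_implements`**: consequently `D` is a SCALAR multiple of the operator of ANY `(g₀, W) ∈ S̃p_ψ(𝕎₁)` over the same `g₀`
  (`W⁻¹ D` commutes with `ρ₀(H(𝕎₁))`, ★ `commutant_schrodingerSB_pi`). [MoeglinVignerasWaldspurger1987, Chap. 2 I.3, II.1 (B)]
USE (N3 (a), the (S5) dictionary `(π, σ, Tr, hTr)` of ★ p834949): with the chart of (E1-CM) the centre `u · 1₃` of `U(V)(L⁺_v)` is frame-diagonal, so by §2 its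
descended action `σ u` on `S_Y` implements the rotation `g₀(u)` of `𝕎₁`; the rank-one Weil representation `ω¹ = lineWeilCM` transported to the dot fibre model
implements the same `g₀(u)` (model matching, (E3)); §3 gives `σ u = c(u) · Tr⁻¹ ω¹(u) Tr` — the dictionary up to the character `c`, whose value
`c = μ_v ∘ det` is N3 (b)'s `m(β)`-weight (D3d) times the Kudla-additivity statement `ν = 1` ((N), the one remaining block).

## References
* [MoeglinVignerasWaldspurger1987] C. Mœglin, M.-F. Vignéras, J.-L. Waldspurger, *Correspondances de Howe sur un corps p-adique*, LNM 1291 (1987):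
  Chap. 2 I.3 (Schur), II.1 (A)–(B); Chap. 3 §IV.2 (mixed model).
* [Kudla1986] S. Kudla, *On the local theta-correspondence*, Invent. Math. 83 (1986): proof of Thm. 2.8.
* [Weil1964] A. Weil, Acta Math. 111 (1964): n° 5 (the section `σ ↦ (σ, f_σ)`).
-/

set_option autoImplicit false
set_option linter.dupNamespace false -- the mandated namespace repeats the single-problem summit's segment

noncomputable section

open Set
open Literature.NumberTheory.Automorphic Literature.RepresentationTheory Literature.RepresentationTheory.HeisenbergGroup
open Summit.HodgeConjecture.HodgeConjecture.Cruxes.H413.F0P2oHeisenbergYCoinvariants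
open Summit.HodgeConjecture.HodgeConjecture.Cruxes.H413.F0P2oHeisenbergYCoinvariantsSchur

namespace Summit.HodgeConjecture.HodgeConjecture.Cruxes.H413.F0P2oFibreDescentImplementer

variable {F : Type*} [Field F] [ValuativeRel F] [TopologicalSpace F] [IsNonarchimedeanLocalField F]
  {ι₁ ι₀ : Type*} [Fintype ι₁] [Fintype ι₀]
  {ψ : AddChar F Circle} (hl : IsLocallyConstant (⇑ψ : F → Circle))
  (hb : ∀ y : ι₁ ⊕ ι₀ → F, Continuous fun u : ι₁ ⊕ ι₀ → F => dotProductBilin F F u y)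
  (hb₀ : ∀ y₀ : ι₀ → F, Continuous fun u₀ : ι₀ → F => dotProductBilin F F u₀ y₀)
  (φ₀ : SchwartzBruhat (ι₁ ⊕ ι₀ → F) →ₗ[ℂ] SchwartzBruhat (ι₀ → F))
  (hφ₀ : ∀ (f : SchwartzBruhat (ι₁ ⊕ ι₀ → F)) (u₀ : ι₀ → F),
    (φ₀ f : (ι₀ → F) → ℂ) u₀ = (f : (ι₁ ⊕ ι₀ → F) → ℂ) (Sum.elim 0 u₀))

/-! ## §1 Weil's section commutes with passing to `Y^⊥ ∕ Y` -/

section Induced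

variable [Invertible (2 : F)] (g : symplecticGroup (polar (dotProductBilin F F (m := ι₁ ⊕ ι₀))))
  (g₀ : symplecticGroup (polar (dotProductBilin F F (m := ι₀))))
  (hYp : ∀ w : (ι₁ ⊕ ι₀ → F) × (ι₁ ⊕ ι₀ → F), w.1 ∘ Sum.inl = 0 →
    (g.1 w).1 ∘ Sum.inl = 0 ∧ ((g.1 w).1 ∘ Sum.inr, (g.1 w).2 ∘ Sum.inr) = g₀.1 (w.1 ∘ Sum.inr, w.2 ∘ Sum.inr))

omit [ValuativeRel F] [TopologicalSpace F] [IsNonarchimedeanLocalField F] [Invertible (2 : F)] in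
/-- on `Y^⊥` the dot pairing only sees the `ι₀`-coordinates: `⟨w.1, w.2⟩ = ⟨w.1|ι₀, w.2|ι₀⟩` when `w.1|ι₁ = 0`. [folklore] -/
theorem dotProduct_eq_of_comp_inl_eq_zero (w : (ι₁ ⊕ ι₀ → F) × (ι₁ ⊕ ι₀ → F)) (hw : w.1 ∘ Sum.inl = 0) :
    w.1 ⬝ᵥ w.2 = (w.1 ∘ Sum.inr) ⬝ᵥ (w.2 ∘ Sum.inr) := by
  conv_lhs => rw [eq_sumElim_zero_of_comp_inl_eq_zero hw]
  exact sumElim_zero_dotProduct _ _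

omit [ValuativeRel F] [TopologicalSpace F] [IsNonarchimedeanLocalField F] in
include hYp in
/-- **Weil's quadratic correction of `g` on `Y^⊥` is that of the induced `g₀` on `Y^⊥ ∕ Y`**: `f_g(w) = f_{g₀}(w|ι₀)` for `w.1|ι₁ = 0`. [cite: Weil1964, n° 5] -/
theorem ofSymplectic_f_eq_of_induced (w : (ι₁ ⊕ ι₀ → F) × (ι₁ ⊕ ι₀ → F)) (hw : w.1 ∘ Sum.inl = 0) :
    (ofSymplectic (polar (dotProductBilin F F (m := ι₁ ⊕ ι₀))) g).f w =
      (ofSymplectic (polar (dotProductBilin F F (m := ι₀))) g₀).f (w.1 ∘ Sum.inr, w.2 ∘ Sum.inr) := by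
  obtain ⟨h1, h2⟩ := hYp w hw
  rw [ofSymplectic_f, ofSymplectic_f, polar_apply, polar_apply, polar_apply, polar_apply, dotProductBilin_apply_apply,
    dotProductBilin_apply_apply, dotProductBilin_apply_apply, dotProductBilin_apply_apply, dotProduct_eq_of_comp_inl_eq_zero _ hw,
    dotProduct_eq_of_comp_inl_eq_zero _ h1, ← h2]

omit [ValuativeRel F] [TopologicalSpace F] [IsNonarchimedeanLocalField F] in
include hYp in
/-- **Weil's section commutes with `Y^⊥ → Y^⊥ ∕ Y`**: for `h ∈ H(Y^⊥)`, `g · h` lies in `H(Y^⊥)` and its image in `H(𝕎₁)` is `g₀ · h̄`. [cite: Weil1964, n° 5] -/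
theorem act_ofSymplectic_inr_eq_of_induced (h : Heisenberg (polar (dotProductBilin F F (m := ι₁ ⊕ ι₀)))) (hh : h.v.1 ∘ Sum.inl = 0) :
    ((ofSymplectic (polar (dotProductBilin F F (m := ι₁ ⊕ ι₀))) g).act h).v.1 ∘ Sum.inl = 0 ∧
      (⟨(((ofSymplectic (polar (dotProductBilin F F (m := ι₁ ⊕ ι₀))) g).act h).v.1 ∘ Sum.inr, ((ofSymplectic (polar (dotProductBilin F F (m := ι₁ ⊕ ι₀))) g).act h).v.2 ∘ Sum.inr), ((ofSymplectic (polar (dotProductBilin F F (m := ι₁ ⊕ ι₀))) g).act h).t⟩ : Heisenberg (polar (dotProductBilin F F (m := ι₀)))) =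
        (ofSymplectic (polar (dotProductBilin F F (m := ι₀))) g₀).act ⟨(h.v.1 ∘ Sum.inr, h.v.2 ∘ Sum.inr), h.t⟩ := by
  obtain ⟨h1, h2⟩ := hYp h.v hh
  refine ⟨?_, ?_⟩
  · rw [Heisenberg.PseudoSymplectic.act_v, ofSymplectic_σ]; exact h1
  · have hv : (((ofSymplectic (polar (dotProductBilin F F (m := ι₁ ⊕ ι₀))) g).act h).v.1 ∘ Sum.inr, ((ofSymplectic (polar (dotProductBilin F F (m := ι₁ ⊕ ι₀))) g).act h).v.2 ∘ Sum.inr) = g₀.1 (h.v.1 ∘ Sum.inr, h.v.2 ∘ Sum.inr) := by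
      rw [Heisenberg.PseudoSymplectic.act_v, ofSymplectic_σ]; exact h2
    have ht : ((ofSymplectic (polar (dotProductBilin F F (m := ι₁ ⊕ ι₀))) g).act h).t =
        h.t + (ofSymplectic (polar (dotProductBilin F F (m := ι₀))) g₀).f (h.v.1 ∘ Sum.inr, h.v.2 ∘ Sum.inr) := by
      rw [Heisenberg.PseudoSymplectic.act_t, ofSymplectic_f_eq_of_induced g g₀ hYp h.v hh]
    rw [hv, ht]
    rfl

end Induced

/-! ## §2 The descended operator implements `g₀` on `S_Y` -/

section Descent

variable [Invertible (2 : F)] (p : MpPsi (schrodingerSB (dotProductBilin F F (m := ι₁ ⊕ ι₀)) ψ hl hb))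
  (g₀ : symplecticGroup (polar (dotProductBilin F F (m := ι₀))))
  (hY : ∀ y₁ : ι₁ → F, ∃ y₁' : ι₁ → F, (p.1.1).1 (0, Sum.elim y₁ 0) = (0, Sum.elim y₁' 0))
  (hYp : ∀ w : (ι₁ ⊕ ι₀ → F) × (ι₁ ⊕ ι₀ → F), w.1 ∘ Sum.inl = 0 →
    ((p.1.1).1 w).1 ∘ Sum.inl = 0 ∧ (((p.1.1).1 w).1 ∘ Sum.inr, ((p.1.1).1 w).2 ∘ Sum.inr) = g₀.1 (w.1 ∘ Sum.inr, w.2 ∘ Sum.inr))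

include hφ₀ hb₀ hY hYp in
/-- **DESCENT OF A `Y`-STABLE IMPLEMENTER**: `(g, M) ∈ S̃p_ψ(𝕎)` with `g Y ⊆ Y`, `g Y^⊥ ⊆ Y^⊥`, `g|_{Y^⊥ ∕ Y} = g₀` descends through `φ₀` to a linear operator `D` of
`S_Y = 𝒮(F^{ι₀})` (`D (φ₀ f) = φ₀ (ω(g, M) f)`), and `D` IMPLEMENTS `ofSymplectic g₀` in the Schrödinger model of `H(𝕎₁)`: `D (ρ₀(h₀) u) = ρ₀(g₀ · h₀) (D u)`.
[cite: MoeglinVignerasWaldspurger1987, Chap. 3 §IV.2] [cite: Kudla1986, proof of Thm. 2.8] [cite: Weil1964, n° 5] -/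
theorem exists_descent_implements (hψ : ψ.IsContinuousNontrivial) :
    ∃ D : SchwartzBruhat (ι₀ → F) →ₗ[ℂ] SchwartzBruhat (ι₀ → F),
      (∀ f : SchwartzBruhat (ι₁ ⊕ ι₀ → F), D (φ₀ f) = φ₀ (MpPsi.toRep (schrodingerSB (dotProductBilin F F) ψ hl hb) p f)) ∧
      ∀ (h₀ : Heisenberg (polar (dotProductBilin F F (m := ι₀)))) (u : SchwartzBruhat (ι₀ → F)),
        D (schrodingerSB (dotProductBilin F F) ψ hl hb₀ h₀ u) =
          schrodingerSB (dotProductBilin F F) ψ hl hb₀ ((ofSymplectic (polar (dotProductBilin F F (m := ι₀))) g₀).act h₀) (D u) := by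
  have hM : Implements (schrodingerSB (dotProductBilin F F) ψ hl hb) (ofSymplectic _ p.1.1) p.1.2 := (mem_MpPsi _ _).1 p.2
  -- `g` maps `Y` into `Y` with NO central correction (the correction on `Y ⊆ Y^⊥` is `f_{g₀}(0) = 0`)
  have hsY : ∀ y₁ : ι₁ → F, ∃ y₁' : ι₁ → F, (ofSymplectic _ p.1.1).act
      (⟨(0, Sum.elim y₁ 0), 0⟩ : Heisenberg (polar (dotProductBilin F F (m := ι₁ ⊕ ι₀)))) = ⟨(0, Sum.elim y₁' 0), 0⟩ := by
    intro y₁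
    obtain ⟨y₁', hy⟩ := hY y₁
    refine ⟨y₁', ?_⟩
    have hf : (ofSymplectic (polar (dotProductBilin F F (m := ι₁ ⊕ ι₀))) p.1.1).f (0, Sum.elim y₁ 0) = 0 := by
      rw [ofSymplectic_f_eq_of_induced p.1.1 g₀ hYp (0, Sum.elim y₁ 0) rfl]
      change (ofSymplectic (polar (dotProductBilin F F (m := ι₀))) g₀).f ((0 : ι₁ ⊕ ι₀ → F) ∘ Sum.inr, (Sum.elim y₁ (0 : ι₀ → F)) ∘ Sum.inr) = 0
      have h0 : (((0 : ι₁ ⊕ ι₀ → F) ∘ Sum.inr, (Sum.elim y₁ (0 : ι₀ → F)) ∘ Sum.inr) : (ι₀ → F) × (ι₀ → F)) = 0 := rfl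
      rw [h0]
      exact Heisenberg.PseudoSymplectic.f_zero _
    change (⟨(p.1.1).1 (0, Sum.elim y₁ 0), 0 + (ofSymplectic (polar (dotProductBilin F F (m := ι₁ ⊕ ι₀))) p.1.1).f (0, Sum.elim y₁ 0)⟩ :
      Heisenberg (polar (dotProductBilin F F (m := ι₁ ⊕ ι₀)))) = _
    rw [hf, add_zero, hy]
  obtain ⟨D, hD⟩ := exists_descent_of_implements hl hb φ₀ hφ₀ (ofSymplectic _ p.1.1) p.1.2 hM hsY hψ
  refine ⟨D, fun f => by rw [MpPsi.toRep_apply]; exact hD f, ?_⟩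
  rintro ⟨⟨x₀, y₀⟩, t⟩ u
  obtain ⟨f, rfl⟩ := fibreZero_surjective φ₀ hφ₀ u
  -- lift `h₀` to `h = ((0 ⊔ x₀, 0 ⊔ y₀), t) ∈ H(Y^⊥)` and use the equivariance of `φ₀`
  have hh : (⟨(Sum.elim 0 x₀, Sum.elim 0 y₀), t⟩ : Heisenberg (polar (dotProductBilin F F (m := ι₁ ⊕ ι₀)))).v.1 ∘ Sum.inl = 0 := rfl
  obtain ⟨h1, h2⟩ := act_ofSymplectic_inr_eq_of_induced p.1.1 g₀ hYp ⟨(Sum.elim 0 x₀, Sum.elim 0 y₀), t⟩ hh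
  rw [← fibreZero_schrodingerSB_sumElim hl hb hb₀ φ₀ hφ₀ x₀ 0 y₀ t f, hD, hD, hM,
    fibreZero_schrodingerSB_of_comp_inl_eq_zero hl hb hb₀ φ₀ hφ₀ _ h1, h2]
  rfl

end Descent

/-! ## §3 Uniqueness: an implementer of `g₀` on `S_Y` is a scalar multiple of any `(g₀, W) ∈ S̃p_ψ(𝕎₁)` -/

section Unique

variable [Invertible (2 : F)] (g₀ : symplecticGroup (polar (dotProductBilin F F (m := ι₀))))
  (D : SchwartzBruhat (ι₀ → F) →ₗ[ℂ] SchwartzBruhat (ι₀ → F))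
  (hD : ∀ (h₀ : Heisenberg (polar (dotProductBilin F F (m := ι₀)))) (u : SchwartzBruhat (ι₀ → F)),
    D (schrodingerSB (dotProductBilin F F) ψ hl hb₀ h₀ u) =
      schrodingerSB (dotProductBilin F F) ψ hl hb₀ ((ofSymplectic (polar (dotProductBilin F F (m := ι₀))) g₀).act h₀) (D u))
  (q : MpPsi (schrodingerSB (dotProductBilin F F (m := ι₀)) ψ hl hb₀)) (hq : q.1.1 = g₀)

include hD hq in
/-- **UNIQUENESS UP TO A SCALAR**: if `D` implements `ofSymplectic g₀` and `(g₀, W) ∈ S̃p_ψ(𝕎₁)`, then `D = c · W` for a scalar `c` (`W⁻¹ D` commutes with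
`ρ₀(H(𝕎₁))`; ★ `commutant_schrodingerSB_pi`). [cite: MoeglinVignerasWaldspurger1987, Chap. 2 I.3, II.1 (B)] -/
theorem exists_eq_smul_toRep_of_implements (hψ : ψ.IsContinuousNontrivial) :
    ∃ c : ℂ, ∀ u : SchwartzBruhat (ι₀ → F), D u = c • MpPsi.toRep (schrodingerSB (dotProductBilin F F) ψ hl hb₀) q u := by
  have hW : Implements (schrodingerSB (dotProductBilin F F) ψ hl hb₀) (ofSymplectic _ g₀) q.1.2 := by
    rw [← hq]; exact (mem_MpPsi _ _).1 q.2
  have hcomm : ∀ (h₀ : Heisenberg (polar (dotProductBilin F F (m := ι₀)))) (u : SchwartzBruhat (ι₀ → F)),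
      (q.1.2.symm.toLinearMap ∘ₗ D) (schrodingerSB (dotProductBilin F F) ψ hl hb₀ h₀ u) =
        schrodingerSB (dotProductBilin F F) ψ hl hb₀ h₀ ((q.1.2.symm.toLinearMap ∘ₗ D) u) := by
    intro h₀ u
    rw [LinearMap.comp_apply, LinearMap.comp_apply, LinearEquiv.coe_toLinearMap, hD, LinearEquiv.symm_apply_eq, hW,
      LinearEquiv.apply_symm_apply]
  obtain ⟨c, hc⟩ := commutant_schrodingerSB_pi hl hb₀ hψ _ hcomm
  refine ⟨c, fun u => ?_⟩
  have h := hc u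
  rw [LinearMap.comp_apply, LinearEquiv.coe_toLinearMap, LinearEquiv.symm_apply_eq, map_smul] at h
  rw [h, MpPsi.toRep_apply]

include hD hq in
/-- … in `Module.End` form: `D = c • ω(g₀, W)`. [cite: MoeglinVignerasWaldspurger1987, Chap. 2 I.3, II.1 (B)] -/
theorem exists_eq_smul_toRep_of_implements' (hψ : ψ.IsContinuousNontrivial) :
    ∃ c : ℂ, D = c • MpPsi.toRep (schrodingerSB (dotProductBilin F F) ψ hl hb₀) q := by
  obtain ⟨c, hc⟩ := exists_eq_smul_toRep_of_implements hl hb₀ g₀ D hD q hq hψ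
  exact ⟨c, LinearMap.ext fun u => by rw [LinearMap.smul_apply, hc]⟩

end Unique

end Summit.HodgeConjecture.HodgeConjecture.Cruxes.H413.F0P2oFibreDescentImplementer

end
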